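import Mathlib
import HarnessLib.Audit
import Summits.PneNP.PneNP.Theorems.PstarSlackTools

/-!
# No centre at slack one: X-connected terminal cores with `2·#bdry K = 3·#K + 1` are centre-free inside the induction (ROUND-24, O1; all `s`; memo g25 §45)

FRONTIER range-avoidance ladder, rung F-N3, ROUND 24 (cell `pnp-ideate`, prover-2 memo `g25/O1-XORSPLIT-g25.md` §45; typed targets
`PstarCoreBoundTargets.TerminalFive` / `TerminalPeelable` (p646951); restricted-model proof complexity — nothing here bears on `P` versus `NP`).

`PstarMaxSharingCentre.no_centre_at_max_sharing` is the slack-`0` layer (`2·#bdry K = 3·#K`).  **`no_centre_at_slack_one`** is the next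
layer, for EVERY sharing pattern: inside the core-bound induction an X-connected terminal core with `2·#bdry K = 3·#K + 1` has no non-empty leafless
set of non-chords.  DEFECT COUNTING: with `u = #xverts K`, `N` the non-chords, `D` the dirty chords (`#D ≤ 1`), `C` the clean chords,
`C₂ ⊆ C` those with an XOR endpoint of degree two: `u ≤ #N + #D` (`PstarSkeletonSpan`), `2·#N ≤ 2·#sharedSlots ≤ #K − 1`,
`#C₂ + 3 ≤ u` (`PstarSlackTools.card_deg2_chords_add_le`).
* `D = ∅`: then `#(C ∖ C₂) ≥ 4`, while any two members of `C ∖ C₂` share an endpoint of degree THREE (`exists_shared_deg_three`) carrying a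
  skeleton member (covered) — so at most one further clean chord per endpoint of a fixed `c₁ ∈ C ∖ C₂`: `#(C ∖ C₂) ≤ 3`.
* `D = {d}`: the inside gate `g` of `d` has both AND variables read by `K`, so `K + g` is boundary-TIGHT (`card_bdry_insert_le`); deleting any
  clean chord from `K + g` (`card_bdry_erase_le`) forces a degree-two endpoint: `C₂ = C`, and `#C = #K − #N − 1 ≤ u − 3 ≤ #N − 2` contradicts
  `2·#N ≤ #K − 1`.
-/

set_option linter.dupNamespace false -- `Summit.PneNP.PneNP.…`: summit = sub-problem name (D-0017 single-conjunct layout)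

open Finset Literature.Computability.Complexity
open Summit.PneNP.PneNP.Theorems.PstarTyped (Typed)
open Summit.PneNP.PneNP.Theorems.PstarSALevel (varSet bdry BoundaryExpanding SimpleOverlap)
open Summit.PneNP.PneNP.Theorems.PstarSAClosure (degIn mem_bdry_iff)
open Summit.PneNP.PneNP.Theorems.PstarXCore (xpair mem_xpair xverts)
open Summit.PneNP.PneNP.Theorems.PstarCentreFree (vars_mem_varSet)
open Summit.PneNP.PneNP.Theorems.PstarCoreBound (XorClosed)
open Summit.PneNP.PneNP.Theorems.PstarChordRepair (IsChord)
open Summit.PneNP.PneNP.Theorems.PstarCoreBoundTargets (Terminal nonchords mem_nonchords)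
open Summit.PneNP.PneNP.Theorems.PstarSharingBound (sharedSlots card_bdry_add_card_sharedSlots_le)
open Summit.PneNP.PneNP.Theorems.PstarChordBridgeTools (xpdeg)
open Summit.PneNP.PneNP.Theorems.PstarChordBridgeExchange (mem_xverts_iff)
open Summit.PneNP.PneNP.Theorems.PstarChordReadSwitches (Touches)
open Summit.PneNP.PneNP.Theorems.PstarChordReadOutside (OutsideGated IsGate)
open Summit.PneNP.PneNP.Theorems.PstarChordReadTwoCleanCount (card_dirty_le_slack)
open Summit.PneNP.PneNP.Theorems.PstarCleanChordCount (card_nonchords_le_card_sharedSlots)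
open Summit.PneNP.PneNP.Theorems.PstarNoFreeVertex (covered_of_terminal mem_varSet_of_mem_xpair)
open Summit.PneNP.PneNP.Theorems.PstarSkeletonSpan (XConnected skel mem_skel card_xverts_le_card_skel)
open Summit.PneNP.PneNP.Theorems.PstarMaxSharingCentre (card_bdry_erase_le)
open Summit.PneNP.PneNP.Theorems.PstarSlackTools (three_le_card_xverts_of_leafless card_deg2_chords_add_le degIn_insert card_bdry_insert_le
  exists_shared_deg_three)

namespace Summit.PneNP.PneNP.Theorems.PstarSlackOneCentre

variable {n m : ℕ} {I : LocalMap 4 n m} {r : ℕ} {y : Fin m → Bool} {K : Finset (Fin m)} {w₁ w₂ : Finset (Fin n) × Finset (Fin m) × Bool}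

/-- **NO CENTRE AT SLACK ONE** (all sharing patterns, all core sizes; inside the core-bound induction).  An X-connected terminal core `K` of a pure
typed `(r,3/2)`-expanding instance with simple overlaps with `2·#bdry K = 3·#K + 1` has no non-empty leafless set of non-chords. -/
theorem no_centre_at_slack_one (hI : I.IsPure xorAndPred) (hT : Typed I) (hS : SimpleOverlap I) (hB : BoundaryExpanding r I)
    (ht : Terminal I r y K w₁ w₂)
    (hIH : ∀ c ∈ K, ∀ K₀ ⊆ K.erase c, ∀ d d' : Finset (Fin n) × Finset (Fin m) × Bool, Terminal I r y K₀ d d' → K₀.card ≤ 5)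
    (hconn : XConnected I K) (hslack : 2 * (bdry I K).card = 3 * K.card + 1) :
    ¬ ∃ S ⊆ K, S.Nonempty ∧ (∀ w ∈ xverts I S, 2 ≤ xpdeg I S w) ∧ ∀ f ∈ S, ¬ IsChord I K f := by
  classical
  rintro ⟨S, hSK, hSne, hSL, hSnc⟩
  have hX : XorClosed I K := ht.2.1
  have hKr : K.card < r := ht.2.2.1
  have hd : Disjoint K (w₁.2.1 ∪ w₂.2.1) := disjoint_union_right.2 ⟨ht.2.2.2.1, ht.2.2.2.2.1⟩
  have hr : (K ∪ (w₁.2.1 ∪ w₂.2.1)).card ≤ r := by rw [← union_assoc]; exact ht.2.2.2.2.2.1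
  set M := w₁.2.1 ∪ w₂.2.1 with hM
  -- sharing and skeleton bookkeeping
  have hbs := card_bdry_add_card_sharedSlots_le I K hX
  have hN := card_nonchords_le_card_sharedSlots I K
  have h2N : 2 * (nonchords I K).card + 1 ≤ K.card := by omega
  set 𝒟 := K.filter fun c => IsChord I K c ∧ ¬ OutsideGated I K M c with h𝒟
  have h𝒟1 : 𝒟.card ≤ 1 :=
    card_dirty_le_slack hB ht (t := 1) (by omega) (filter_subset _ K) (fun c hc => (mem_filter.1 hc).2.1) (fun c hc => (mem_filter.1 hc).2.2)
  have hskel : skel I K M ⊆ nonchords I K ∪ 𝒟 := by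
    intro f hf
    obtain ⟨hfK, hnot⟩ := (mem_skel I).1 hf
    by_cases hch : IsChord I K f
    · exact mem_union_right _ (mem_filter.2 ⟨hfK, hch, fun hO => hnot ⟨hch, hO⟩⟩)
    · exact mem_union_left _ ((mem_nonchords I).2 ⟨hfK, hch⟩)
  have hu : (xverts I K).card ≤ (nonchords I K).card + 𝒟.card :=
    ((card_xverts_le_card_skel hI hT hS hB ht hIH hconn ⟨S, hSK, hSne, hSL, hSnc⟩).trans (card_le_card hskel)).trans
      (card_union_le _ _)
  -- clean chords, and those with a degree-two endpoint
  set C := K.filter fun c => IsChord I K c ∧ OutsideGated I K M c with hC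
  have hsplit : C.card + 𝒟.card + (nonchords I K).card = K.card := by
    have h1 := card_filter_add_card_filter_not (s := K) (fun c => IsChord I K c)
    have e : (K.filter fun c => ¬ IsChord I K c) = nonchords I K := by ext f; rw [mem_filter, mem_nonchords]
    rw [e] at h1
    have h2 := card_filter_add_card_filter_not (s := K.filter fun c => IsChord I K c) (fun c => OutsideGated I K M c)
    rw [filter_filter, filter_filter] at h2
    rw [hC, h𝒟]
    omega
  set C₂ := C.filter fun c => ∃ w ∈ xpair I c, degIn I K w = 2 with hC₂
  set C'' := C.filter fun c => ¬ ∃ w ∈ xpair I c, degIn I K w = 2 with hC''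
  have hCsplit : C₂.card + C''.card = C.card := card_filter_add_card_filter_not _
  have hcov := covered_of_terminal hI hT hS hB ht
  have hC₂ : C₂.card + (xverts I S).card ≤ (xverts I K).card :=
    card_deg2_chords_add_le I hI hcov (fun c hc => by
      obtain ⟨hcC, hw⟩ := mem_filter.1 hc
      obtain ⟨hcK, hch, hO⟩ := mem_filter.1 hcC
      exact ⟨hcK, hch, hO, hw⟩) hSK hSL hSnc
  have h3 := three_le_card_xverts_of_leafless I hI hS hSne hSL
  -- degrees of XOR vertices are at least two
  have hdeg2 : ∀ c ∈ K, ∀ w ∈ xpair I c, 2 ≤ degIn I K w := by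
    intro c hc w hw
    have h1 : degIn I K w ≠ 1 := by
      intro h1
      have hb := (mem_bdry_iff I K w).2 h1
      rcases (mem_xpair I).1 hw with h | h
      · exact hX c hc 0 (by decide) (h ▸ hb)
      · exact hX c hc 1 (by decide) (h ▸ hb)
    have h0 : 0 < degIn I K w := by
      unfold PstarSAClosure.degIn; exact card_pos.2 ⟨c, mem_filter.2 ⟨hc, mem_varSet_of_mem_xpair hw⟩⟩
    omega
  by_cases hD : 𝒟.card = 0
  · -- CASE `D = ∅`: four clean chords without degree-two endpoints, pairwise sharing degree-three endpoints
    have h4 : 4 ≤ C''.card := by omega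
    have pair : ∀ c ∈ C'', ∀ c' ∈ C'', c ≠ c' → ∃ w ∈ xpair I c, w ∈ xpair I c' ∧ degIn I K w = 3 := by
      intro c hc c' hc' hne
      obtain ⟨hcC, hno⟩ := mem_filter.1 hc
      obtain ⟨hc'C, hno'⟩ := mem_filter.1 hc'
      obtain ⟨hcK, hch, -⟩ := mem_filter.1 hcC
      obtain ⟨hc'K, hch', -⟩ := mem_filter.1 hc'C
      push Not at hno hno'
      exact exists_shared_deg_three I hI hT hB hKr.le (by omega) hcK hc'K hne hch hch' hno hno'
    -- at a degree-three vertex there are at most two clean chords (one reader is a non-clean member)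
    have atmost : ∀ (w : Fin n) (a b c : Fin m), a ∈ C → b ∈ C → c ∈ C → a ≠ b → a ≠ c → b ≠ c →
        w ∈ xpair I a → w ∈ xpair I b → w ∈ xpair I c → degIn I K w ≠ 3 := by
      intro w a b c ha hb hc hab hac hbc hwa hwb hwc h3w
      obtain ⟨haK, hach, haO⟩ := mem_filter.1 ha
      obtain ⟨hbK, hbch, hbO⟩ := mem_filter.1 hb
      obtain ⟨hcK, hcch, hcO⟩ := mem_filter.1 hc
      obtain ⟨f, hf, hwf, hnot⟩ := hcov w ((mem_xverts_iff I K w).2 ⟨a, haK, hwa⟩)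
      have hfa : f ≠ a := fun h => hnot (h ▸ ⟨hach, haO⟩)
      have hfb : f ≠ b := fun h => hnot (h ▸ ⟨hbch, hbO⟩)
      have hfc : f ≠ c := fun h => hnot (h ▸ ⟨hcch, hcO⟩)
      have hsub : ({a, b, c, f} : Finset (Fin m)) ⊆ K.filter fun j => w ∈ varSet I j := by
        intro j hj
        rw [mem_filter]
        rcases mem_insert.1 hj with rfl | hj
        · exact ⟨haK, mem_varSet_of_mem_xpair hwa⟩
        rcases mem_insert.1 hj with rfl | hj
        · exact ⟨hbK, mem_varSet_of_mem_xpair hwb⟩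
        rcases mem_insert.1 hj with rfl | hj
        · exact ⟨hcK, mem_varSet_of_mem_xpair hwc⟩
        · rw [mem_singleton.1 hj]; exact ⟨hf, mem_varSet_of_mem_xpair hwf⟩
      have hcard : ({a, b, c, f} : Finset (Fin m)).card = 4 := by
        rw [card_insert_of_notMem, card_insert_of_notMem, card_pair hfc.symm]
        · rw [mem_insert, mem_singleton]; push Not; exact ⟨hbc, hfb.symm⟩
        · rw [mem_insert, mem_insert, mem_singleton]; push Not; exact ⟨hab, hac, hfa.symm⟩
      have := hcard ▸ card_le_card hsub
      unfold PstarSAClosure.degIn at h3w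
      omega
    -- pick `c₁` and three further members of `C''`
    obtain ⟨c₁, hc₁⟩ : C''.Nonempty := card_pos.1 (by omega)
    obtain ⟨c₂, hc₂⟩ : (C''.erase c₁).Nonempty := card_pos.1 (by rw [card_erase_of_mem hc₁]; omega)
    obtain ⟨c₃, hc₃⟩ : ((C''.erase c₁).erase c₂).Nonempty := card_pos.1 (by
      rw [card_erase_of_mem hc₂, card_erase_of_mem hc₁]; omega)
    obtain ⟨c₄, hc₄⟩ : (((C''.erase c₁).erase c₂).erase c₃).Nonempty := card_pos.1 (by
      rw [card_erase_of_mem hc₃, card_erase_of_mem hc₂, card_erase_of_mem hc₁]; omega)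
    have h21 : c₂ ≠ c₁ := (mem_erase.1 hc₂).1
    have hc₂'' : c₂ ∈ C'' := mem_of_mem_erase hc₂
    have h32 : c₃ ≠ c₂ := (mem_erase.1 hc₃).1
    have h31 : c₃ ≠ c₁ := (mem_erase.1 (mem_of_mem_erase hc₃)).1
    have hc₃'' : c₃ ∈ C'' := mem_of_mem_erase (mem_of_mem_erase hc₃)
    have h43 : c₄ ≠ c₃ := (mem_erase.1 hc₄).1
    have h42 : c₄ ≠ c₂ := (mem_erase.1 (mem_of_mem_erase hc₄)).1
    have h41 : c₄ ≠ c₁ := (mem_erase.1 (mem_of_mem_erase (mem_of_mem_erase hc₄))).1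
    have hc₄'' : c₄ ∈ C'' := mem_of_mem_erase (mem_of_mem_erase (mem_of_mem_erase hc₄))
    have hC''C : C'' ⊆ C := filter_subset _ _
    obtain ⟨x₂, hx₂1, hx₂2, hd₂⟩ := pair c₁ hc₁ c₂ hc₂'' h21.symm
    obtain ⟨x₃, hx₃1, hx₃3, hd₃⟩ := pair c₁ hc₁ c₃ hc₃'' h31.symm
    obtain ⟨x₄, hx₄1, hx₄4, hd₄⟩ := pair c₁ hc₁ c₄ hc₄'' h41.symm
    -- two of `x₂, x₃, x₄ ∈ xpair c₁ = {a, b}` coincide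
    have two : ∀ u v w : Fin n, u ∈ xpair I c₁ → v ∈ xpair I c₁ → w ∈ xpair I c₁ → u = v ∨ u = w ∨ v = w := by
      intro u v w hu hv hw
      rcases (mem_xpair I).1 hu with rfl | rfl <;> rcases (mem_xpair I).1 hv with rfl | rfl <;>
        rcases (mem_xpair I).1 hw with h | h <;> simp [h]
    rcases two x₂ x₃ x₄ hx₂1 hx₃1 hx₄1 with h | h | h
    · exact atmost x₂ c₁ c₂ c₃ (hC''C hc₁) (hC''C hc₂'') (hC''C hc₃'') h21.symm h31.symm h32.symm hx₂1 hx₂2 (h ▸ hx₃3) hd₂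
    · exact atmost x₂ c₁ c₂ c₄ (hC''C hc₁) (hC''C hc₂'') (hC''C hc₄'') h21.symm h41.symm h42.symm hx₂1 hx₂2 (h ▸ hx₄4) hd₂
    · exact atmost x₃ c₁ c₃ c₄ (hC''C hc₁) (hC''C hc₃'') (hC''C hc₄'') h31.symm h41.symm h43.symm hx₃1 hx₃3 (h ▸ hx₄4) hd₃
  · -- CASE `D = {d}`: the gate family `K + g` is tight, so every clean chord has a degree-two endpoint
    have hD1 : 𝒟.card = 1 := by omega
    obtain ⟨d, hd𝒟⟩ := card_pos.1 (by omega : 0 < 𝒟.card)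
    obtain ⟨hdK, hdch, hdO⟩ := mem_filter.1 hd𝒟
    -- the inside monomial `g` on `d`
    unfold PstarChordReadOutside.OutsideGated at hdO
    push Not at hdO
    obtain ⟨g, hgM, htouch, hnogate⟩ := hdO
    have hgK : g ∉ K := fun h => disjoint_left.1 hd h hgM
    -- a private `v` of `d` in an AND slot `i` of `g`, the other AND slot `z` read by `K`
    have slot : ∃ v z : Fin n, (v = I.vars d 2 ∨ v = I.vars d 3) ∧
        ((I.vars g 2 = v ∧ I.vars g 3 = z) ∨ (I.vars g 2 = z ∧ I.vars g 3 = v)) := by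
      unfold PstarChordReadSwitches.Touches at htouch
      by_cases ha : I.vars g 2 = I.vars d 2
      · exact ⟨_, I.vars g 3, Or.inl rfl, Or.inl ⟨ha, rfl⟩⟩
      by_cases hb : I.vars g 3 = I.vars d 2
      · exact ⟨_, I.vars g 2, Or.inl rfl, Or.inr ⟨rfl, hb⟩⟩
      by_cases hc : I.vars g 2 = I.vars d 3
      · exact ⟨_, I.vars g 3, Or.inr rfl, Or.inl ⟨hc, rfl⟩⟩
      by_cases he : I.vars g 3 = I.vars d 3
      · exact ⟨_, I.vars g 2, Or.inr rfl, Or.inr ⟨rfl, he⟩⟩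
      exact (htouch ⟨⟨ha, hb⟩, ⟨hc, he⟩⟩).elim
    obtain ⟨v, z, hv, hvz⟩ := slot
    have hzK : ∃ j ∈ K, z ∈ varSet I j := by
      by_contra hz
      push Not at hz
      exact hnogate v z ⟨hv, hvz, hz⟩
    have hvK : v ∈ varSet I d := by rcases hv with rfl | rfl <;> exact vars_mem_varSet I d _
    have hvb : v ∈ bdry I K := by rcases hv with rfl | rfl <;> [exact hdch.1; exact hdch.2]
    have hg2 : ∃ j ∈ K, I.vars g 2 ∈ varSet I j := by
      rcases hvz with ⟨h2, -⟩ | ⟨h2, -⟩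
      · exact ⟨d, hdK, h2 ▸ hvK⟩
      · rw [h2]; exact hzK
    have hg3 : ∃ j ∈ K, I.vars g 3 ∈ varSet I j := by
      rcases hvz with ⟨-, h3⟩ | ⟨-, h3⟩
      · rw [h3]; exact hzK
      · exact ⟨d, hdK, h3 ▸ hvK⟩
    have hvg : v ∈ varSet I g := by
      rcases hvz with ⟨h2, -⟩ | ⟨-, h3⟩
      · exact h2 ▸ vars_mem_varSet I g 2
      · exact h3 ▸ vars_mem_varSet I g 3
    -- the gate family `F = K + g` and its tight boundary
    set F := insert g K with hF
    have hFr : F.card ≤ r := by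
      refine le_trans (card_le_card ?_) hr
      rw [hF]; exact insert_subset (mem_union_right _ hgM) subset_union_left
    have hbF : (bdry I F).card + 1 ≤ (bdry I K).card + 2 := card_bdry_insert_le I hgK hg2 hg3 hvb hvg
    have hexpF := hB F hFr
    have hFcard : F.card = K.card + 1 := by rw [hF, card_insert_of_notMem hgK]
    -- the AND variables of `g` are read by `K`, so `g` is a gate on no chord; clean chords stay chords of `F`
    have gAnd : ∀ s : Fin 4, 2 ≤ s.val → ∃ j ∈ K, I.vars g s ∈ varSet I j := by
      intro s hs
      have h4 : ∀ t : Fin 4, 2 ≤ t.val → t = 2 ∨ t = 3 := by decide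
      rcases h4 s hs with rfl | rfl
      · exact hg2
      · exact hg3
    have notouch : ∀ c ∈ C, ∀ s : Fin 4, 2 ≤ s.val → I.vars c s ∉ varSet I g := by
      intro c hc s hs hmem
      obtain ⟨hcK, hch, hO⟩ := mem_filter.1 hc
      unfold PstarSALevel.varSet at hmem
      obtain ⟨s', -, hs'⟩ := mem_image.1 hmem
      by_cases hs'2 : 2 ≤ s'.val
      · -- `g` touches `c`: it would be an outside gate on `c`, but both AND variables of `g` are read by `K`
        have h4 : ∀ t : Fin 4, 2 ≤ t.val → t = 2 ∨ t = 3 := by decide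
        have hvc : I.vars c s = I.vars c 2 ∨ I.vars c s = I.vars c 3 := by
          rcases h4 s hs with rfl | rfl
          · exact Or.inl rfl
          · exact Or.inr rfl
        have hgs : I.vars g 2 = I.vars c s ∨ I.vars g 3 = I.vars c s := by
          rcases h4 s' hs'2 with rfl | rfl
          · exact Or.inl hs'
          · exact Or.inr hs'
        obtain ⟨v', z', hG⟩ := hO g hgM (PstarChordReadOutside.touches_of_slot hvc hgs)
        rcases hG.2.1 with ⟨-, h3⟩ | ⟨h2, -⟩
        · obtain ⟨j, hj, hjz⟩ := gAnd 3 (by decide); exact hG.2.2 j hj (h3 ▸ hjz)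
        · obtain ⟨j, hj, hjz⟩ := gAnd 2 (by decide); exact hG.2.2 j hj (h2 ▸ hjz)
      · -- an XOR slot of `g` holds an AND variable of `c`: untyped
        push Not at hs'2
        exact hT g c s' s hs'2 hs hs'
    have chordF : ∀ c ∈ C, IsChord I F c := by
      intro c hc
      obtain ⟨hcK, hch, -⟩ := mem_filter.1 hc
      have key : ∀ s : Fin 4, 2 ≤ s.val → I.vars c s ∈ bdry I K → I.vars c s ∈ bdry I F := by
        intro s hs hb
        rw [mem_bdry_iff] at hb ⊢
        rw [hF, degIn_insert I hgK, if_neg (notouch c hc s hs), hb]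
      exact ⟨key 2 (by decide) hch.1, key 3 (by decide) hch.2⟩
    -- every clean chord has a degree-two endpoint
    have all2 : ∀ c ∈ C, ∃ w ∈ xpair I c, degIn I K w = 2 := by
      intro c hc
      obtain ⟨hcK, hch, -⟩ := mem_filter.1 hc
      have hcF : c ∈ F := by rw [hF]; exact mem_insert_of_mem hcK
      have h1 := card_bdry_erase_le I hI hcF (chordF c hc)
      have hexp := hB (F.erase c) ((card_le_card (erase_subset c F)).trans hFr)
      rw [card_erase_of_mem hcF, hFcard] at hexp
      have hpos : 0 < ((xpair I c).filter fun w => degIn I F w = 2).card := by omega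
      obtain ⟨w, hw⟩ := card_pos.1 hpos
      obtain ⟨hwc, hdw⟩ := mem_filter.1 hw
      refine ⟨w, hwc, ?_⟩
      have hd' := degIn_insert I hgK w
      rw [← hF, hdw] at hd'
      have := hdeg2 c hcK w hwc
      by_cases hwg : w ∈ varSet I g
      · rw [if_pos hwg] at hd'; omega
      · rw [if_neg hwg] at hd'; omega
    have hC''0 : C''.card = 0 := card_eq_zero.2 (filter_eq_empty_iff.2 fun c hc h => h (all2 c hc))
    have hCle : C.card + 3 ≤ (nonchords I K).card + 1 := by omega
    have hCeq : C.card + 1 + (nonchords I K).card = K.card := by omega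
    omega

end Summit.PneNP.PneNP.Theorems.PstarSlackOneCentre
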